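import Literature.AlgebraicGeometry.Milne1999.SpecialLefschetzGroupOneIsogenyFactors
import HarnessLib

/-!
# Milne's Cor. 4.7 on `H¹` for two isogeny types: `L(X)(ℂ)|_{H¹} ≅ G(B)(h_B) ×_{𝔾_m} G(C)(h_C)` for
# `X ∼ B^{r+1} × C^{s+1}`, `Hom(B, C) = 0 = Hom(C, B)` — the multiplier survives the diagonal, powers drop out

Milne [Milne1999LefschetzClasses, Cor. 4.7 (p. 659)]: «An isogeny `A → A₁^{r₁} × ⋯ × A_s^{r_s}` with the `Aᵢ` simple and pairwise
nonisogenous defines an isomorphism `(L(A), l(A)) → ∏ᵢ (L(Aᵢ), l(Aᵢ))`», the product being that of Def. 4.6 («the largest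
subgroup of `∏ Gᵢ` on which the characters agree»); proof p. 660 via `0 → S → L → 𝔾_m → 0` and Prop. 1.5; §1 p. 643 («the
involution [`D`] defines on `C(A)` is the restriction of the product of the involutions»).

The `ker l` half is `Milne1999/SpecialLefschetzGroupOneIsogenyFactors`. Here (all `theorem`s, no definition, no named fact):
* §1 the multiplier is read through the diagonal: `u^{⊕(a+1)}` multiplies `Q_{Σ prᵢ^* h}` by `c` iff `u` multiplies `Q_h` by `c`
  (`polarizationPairingOne_diagPow_eq_smul_iff`); Thm. 4.4 on `H¹` for the product class of `B^{r+1} × C^{s+1}` from the four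
  properties of `h_B`, `h_C`;
* §2 **`L(B^{r+1} × C^{s+1})(ℂ)|_{H¹} = {s^{⊕(r+1)} ⊕ t^{⊕(s+1)} | (s, t) ∈ G(B)(h_B) ×_{𝔾_m} G(C)(h_C)}`** for `Hom(B, C) = 0 = Hom(C, B)`
  and `h_B`, `h_C` with the four properties (in particular polarization classes), and the abstract-group isomorphism
  **`L(B^{r+1} × C^{s+1})(ℂ)|_{H¹} ≅ similitudeCentralizerGroupFibreProd B C h_B h_C`**;
* §3 the same for every `X ∼ B^{r+1} × C^{s+1}`, in particular `B`, `C` simple and non-isogenous.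

## References

* [Milne1999LefschetzClasses] J. S. Milne, *Lefschetz classes on abelian varieties*, Duke Math. J. 96 (1999), §1 p. 643, Prop. 1.5,
  Thm. 4.4, Def. 4.6, Cor. 4.7 (pp. 659–660).
* [LangeBirkenhake1992] H. Lange, Ch. Birkenhake, *Complex Abelian Varieties* (1992), §5.3 (product polarization).
-/

noncomputable section

open CategoryTheory
open Literature.AlgebraicTopology.SingularHomology
open Literature.AlgebraicGeometry.Motives
open Literature.AlgebraicGeometry.HodgeTheory
open Literature.AlgebraicGeometry.VanGeemen1994 (hodgeClassSpan)
open Literature.Geometry.Kaehler (lefschetzPow)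

namespace Literature.AlgebraicGeometry.Milne1999

/-! ### §1 The multiplier through the diagonal; Thm. 4.4 on `H¹` for the product class of `B^{r+1} × C^{s+1}` -/

section Multiplier

variable {A : AbelianVariety ℂ} {h : complexBetti A.X 2} {u : complexBetti A.X 1 ≃ₗ[ℂ] complexBetti A.X 1}

/-- **`u^{⊕(a+1)}` multiplies `Q_{Σ prᵢ^* h}` by `c` iff `u` multiplies `Q_h` by `c`** (`u ∈ C(A)`, `0 < dim A`, `h^{dim A} ≠ 0`):
the tree's `polarizationPairingOne_diagPow_eq_smul` and, conversely, the last block of `u^{⊕(a+1)}` is `u`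
(`polarizationPairingOne_prodRestrictSnd_eq_smul`). [cite: Milne1999LefschetzClasses, §1 p. 643 and §4 p. 659] -/
theorem polarizationPairingOne_diagPow_eq_smul_iff (hA0 : 0 < A.dim) (htop : lefschetzPow h (A.dim - 1) 2 h ≠ 0)
    (hu : u ∈ centralizerGroup A) (c : ℂ) :
    ∀ a : ℕ,
      (∀ x y : complexBetti (A.powSucc a).X 1,
        polarizationPairingOne (A.powSucc a).X (powPolarizationClass A h a) ((A.powSucc a).dim - 1)
            (diagPow A u a x) (diagPow A u a y) =
          c • polarizationPairingOne (A.powSucc a).X (powPolarizationClass A h a) ((A.powSucc a).dim - 1) x y) ↔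
      ∀ x y : complexBetti A.X 1, polarizationPairingOne A.X h (A.dim - 1) (u x) (u y) =
        c • polarizationPairingOne A.X h (A.dim - 1) x y
  | 0 => Iff.rfl
  | a + 1 => by
    refine ⟨fun H b b' ↦ ?_, fun H ↦ polarizationPairingOne_diagPow_eq_smul hA0 hu c H (a + 1)⟩
    have H' : ∀ x y : complexBetti ((A.powSucc a).prod A).X 1,
        polarizationPairingOne ((A.powSucc a).prod A).X (prodPolarizationClass (A.powSucc a) A (powPolarizationClass A h a) h)
            (((A.powSucc a).prod A).dim - 1) (diagPow A u (a + 1) x) (diagPow A u (a + 1) y) =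
          c • polarizationPairingOne ((A.powSucc a).prod A).X
            (prodPolarizationClass (A.powSucc a) A (powPolarizationClass A h a) h) (((A.powSucc a).prod A).dim - 1) x y := H
    have e := polarizationPairingOne_prodRestrictSnd_eq_smul (powPolarizationClass A h a) h
      (lefschetzPow_powPolarizationClass_self_ne_zero hA0 htop a) (diagPow_mem_centralizerGroup hu (a + 1)) c H' b b'
    rwa [prodRestrictSnd_diagPow_succ, prodRestrictSnd_diagPow_succ] at e

end Multiplier

section Product

variable (B C : AbelianVariety ℂ) {hB : complexBetti B.X 2} {hC : complexBetti C.X 2}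

/-- **Thm. 4.4 on `H¹` for the product class `pr^* (Σ prᵢ^* h_B) + pr^* (Σ prⱼ^* h_C)` of `B^{r+1} × C^{s+1}`** from the four
properties of `h_B`, `h_C`. [cite: Milne1999LefschetzClasses, Thm. 4.4 and §1 p. 643] [cite: LangeBirkenhake1992, §5.3] -/
theorem specialLefschetzGroup_map_one_powSucc_prod_powSucc_eq_unitaryCentralizerGroup
    (hQB : IsRationalClass hB) (h11B : IsOfHodgeType B.dim B.X 2 1 1 hB) (hBtop : lefschetzPow hB (B.dim - 1) 2 hB ≠ 0)
    (hndB : ∀ x : complexBetti B.X 1, (∀ y, polarizationPairingOne B.X hB (B.dim - 1) x y = 0) → x = 0)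
    (hQC : IsRationalClass hC) (h11C : IsOfHodgeType C.dim C.X 2 1 1 hC) (hCtop : lefschetzPow hC (C.dim - 1) 2 hC ≠ 0)
    (hndC : ∀ x : complexBetti C.X 1, (∀ y, polarizationPairingOne C.X hC (C.dim - 1) x y = 0) → x = 0) (r s : ℕ) :
    (specialLefschetzGroup ((B.powSucc r).prod (C.powSucc s)).dim ((B.powSucc r).prod (C.powSucc s)).X).map
        (Pi.evalMonoidHom (fun k : ℕ ↦ complexBetti ((B.powSucc r).prod (C.powSucc s)).X k ≃ₗ[ℂ]
          complexBetti ((B.powSucc r).prod (C.powSucc s)).X k) 1) =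
      unitaryCentralizerGroup ((B.powSucc r).prod (C.powSucc s))
        (prodPolarizationClass (B.powSucc r) (C.powSucc s) (powPolarizationClass B hB r) (powPolarizationClass C hC s)) :=
  have hB0 : 0 < B.dim := dim_pos_of_lefschetzPow_ne_zero hBtop
  have hC0 : 0 < C.dim := dim_pos_of_lefschetzPow_ne_zero hCtop
  specialLefschetzGroup_map_one_prod_eq_unitaryCentralizerGroup (B.powSucc r) (C.powSucc s)
    (isRationalClass_powPolarizationClass hQB r) (isOfHodgeType_powPolarizationClass h11B r)
    (lefschetzPow_powPolarizationClass_self_ne_zero hB0 hBtop r)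
    (eq_zero_of_forall_polarizationPairingOne_powPolarizationClass_eq_zero hB0 hBtop hndB r)
    (isRationalClass_powPolarizationClass hQC s) (isOfHodgeType_powPolarizationClass h11C s)
    (lefschetzPow_powPolarizationClass_self_ne_zero hC0 hCtop s)
    (eq_zero_of_forall_polarizationPairingOne_powPolarizationClass_eq_zero hC0 hCtop hndC s)

/-- **`L(B^{r+1} × C^{s+1})(ℂ)|_{H¹} = G(B^{r+1} × C^{s+1})(product class)(ℂ)`** from the four properties of `h_B`, `h_C`.
[cite: Milne1999LefschetzClasses, Thm. 4.4, §4 p. 659 and Cor. 4.7] -/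
theorem lefschetzGroup_map_one_powSucc_prod_powSucc_eq_similitudeCentralizerGroup
    (hQB : IsRationalClass hB) (h11B : IsOfHodgeType B.dim B.X 2 1 1 hB) (hBtop : lefschetzPow hB (B.dim - 1) 2 hB ≠ 0)
    (hndB : ∀ x : complexBetti B.X 1, (∀ y, polarizationPairingOne B.X hB (B.dim - 1) x y = 0) → x = 0)
    (hQC : IsRationalClass hC) (h11C : IsOfHodgeType C.dim C.X 2 1 1 hC) (hCtop : lefschetzPow hC (C.dim - 1) 2 hC ≠ 0)
    (hndC : ∀ x : complexBetti C.X 1, (∀ y, polarizationPairingOne C.X hC (C.dim - 1) x y = 0) → x = 0) (r s : ℕ) :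
    (lefschetzGroup ((B.powSucc r).prod (C.powSucc s)).dim ((B.powSucc r).prod (C.powSucc s)).X).map
        (Pi.evalMonoidHom (fun k : ℕ ↦ complexBetti ((B.powSucc r).prod (C.powSucc s)).X k ≃ₗ[ℂ]
          complexBetti ((B.powSucc r).prod (C.powSucc s)).X k) 1) =
      similitudeCentralizerGroup ((B.powSucc r).prod (C.powSucc s))
        (prodPolarizationClass (B.powSucc r) (C.powSucc s) (powPolarizationClass B hB r) (powPolarizationClass C hC s)) :=
  have hhB : hB ∈ hodgeClassSpan B.dim B.X 1 := Submodule.subset_span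
    (show hB ∈ {c : complexBetti B.X (2 * 1) | IsRationalClass c ∧ IsOfHodgeType B.dim B.X (2 * 1) 1 1 c} from ⟨hQB, h11B⟩)
  have hhC : hC ∈ hodgeClassSpan C.dim C.X 1 := Submodule.subset_span
    (show hC ∈ {c : complexBetti C.X (2 * 1) | IsRationalClass c ∧ IsOfHodgeType C.dim C.X (2 * 1) 1 1 c} from ⟨hQC, h11C⟩)
  lefschetzGroup_map_one_eq_similitudeCentralizerGroup_of_eq
    (prodPolarizationClass_mem_hodgeClassSpan _ _ (powPolarizationClass_mem_hodgeClassSpan hhB r)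
      (powPolarizationClass_mem_hodgeClassSpan hhC s))
    (specialLefschetzGroup_map_one_powSucc_prod_powSucc_eq_unitaryCentralizerGroup B C hQB h11B hBtop hndB hQC h11C hCtop
      hndC r s)

/-! ### §2 `L(B^{r+1} × C^{s+1})(ℂ)|_{H¹} ≅ G(B)(h_B) ×_{𝔾_m} G(C)(h_C)` for `Hom(B, C) = 0 = Hom(C, B)` -/

/-- **`G(B^{r+1} × C^{s+1})(product class)(ℂ) = {s^{⊕(r+1)} ⊕ t^{⊕(s+1)} | (s, t) ∈ G(B)(h_B) ×_{𝔾_m} G(C)(h_C)}`** for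
`Hom(B, C) = 0 = Hom(C, B)` (`h_B^{dim B} ≠ 0 ≠ h_C^{dim C}`): an element of `C(B^{r+1} × C^{s+1})` is block diagonal with
diagonal blocks `s^{⊕(r+1)}`, `t^{⊕(s+1)}`, and the common multiplier of the two blocks is that of `s` and `t`.
[cite: Milne1999LefschetzClasses, §1 p. 643, Def. 4.6 and Cor. 4.7] -/
theorem mem_similitudeCentralizerGroup_powSucc_prod_powSucc_iff (hBC : ∀ f : B ⟶ C, f = 0) (hCB : ∀ g : C ⟶ B, g = 0)
    (hBtop : lefschetzPow hB (B.dim - 1) 2 hB ≠ 0) (hCtop : lefschetzPow hC (C.dim - 1) 2 hC ≠ 0) (r s : ℕ)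
    (U : complexBetti ((B.powSucc r).prod (C.powSucc s)).X 1 ≃ₗ[ℂ] complexBetti ((B.powSucc r).prod (C.powSucc s)).X 1) :
    U ∈ similitudeCentralizerGroup ((B.powSucc r).prod (C.powSucc s))
        (prodPolarizationClass (B.powSucc r) (C.powSucc s) (powPolarizationClass B hB r) (powPolarizationClass C hC s)) ↔
      ∃ p ∈ similitudeCentralizerGroupFibreProd B C hB hC, prodBlockDiagEquiv (diagPow B p.1 r) (diagPow C p.2 s) = U := by
  have hB0 : 0 < B.dim := dim_pos_of_lefschetzPow_ne_zero hBtop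
  have hC0 : 0 < C.dim := dim_pos_of_lefschetzPow_ne_zero hCtop
  have hPtop := lefschetzPow_powPolarizationClass_self_ne_zero hB0 hBtop r
  have hQtop := lefschetzPow_powPolarizationClass_self_ne_zero hC0 hCtop s
  constructor
  · intro hU
    obtain ⟨c, hc₁, hc₂⟩ := (mem_similitudeCentralizerGroup_prod_iff hPtop hQtop ⟨U, hU.1⟩).1 hU
    obtain ⟨s₀, hs₀, es⟩ := exists_eq_diagPow_of_mem_centralizerGroup r _
      (centralizerGroup.restrictFstHom_mem (⟨U, hU.1⟩ : centralizerGroup ((B.powSucc r).prod (C.powSucc s))))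
    obtain ⟨t₀, ht₀, et⟩ := exists_eq_diagPow_of_mem_centralizerGroup s _
      (centralizerGroup.restrictSndHom_mem (⟨U, hU.1⟩ : centralizerGroup ((B.powSucc r).prod (C.powSucc s))))
    refine ⟨(s₀, t₀), ⟨hs₀, ht₀, c, ?_, ?_⟩, ?_⟩
    · refine (polarizationPairingOne_diagPow_eq_smul_iff hB0 hBtop hs₀ c r).1 fun x y ↦ ?_
      rw [es]
      exact hc₁ x y
    · refine (polarizationPairingOne_diagPow_eq_smul_iff hC0 hCtop ht₀ c s).1 fun x y ↦ ?_
      rw [et]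
      exact hc₂ x y
    · change prodBlockDiagEquiv (diagPow B s₀ r) (diagPow C t₀ s) = U
      rw [es, et]
      exact centralizerGroup.prodBlockDiagEquiv_restrictHom ⟨U, hU.1⟩
  · rintro ⟨p, ⟨hp₁, hp₂, c, hc₁, hc₂⟩, rfl⟩
    have hmem : prodBlockDiagEquiv (diagPow B p.1 r) (diagPow C p.2 s) ∈ centralizerGroup ((B.powSucc r).prod (C.powSucc s)) :=
      prodBlockDiagEquiv_mem_centralizerGroup (hom_powSucc_eq_zero_of_forall_hom_eq_zero hBC r s)
        (hom_powSucc_eq_zero_of_forall_hom_eq_zero hCB s r) (diagPow_mem_centralizerGroup hp₁ r)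
        (diagPow_mem_centralizerGroup hp₂ s)
    refine (mem_similitudeCentralizerGroup_prod_iff hPtop hQtop ⟨_, hmem⟩).2 ⟨c, ?_, ?_⟩
    · rw [centralizerGroup.restrictFstHom_prodBlockDiagEquiv hmem]
      exact (polarizationPairingOne_diagPow_eq_smul_iff hB0 hBtop hp₁ c r).2 hc₁
    · rw [centralizerGroup.restrictSndHom_prodBlockDiagEquiv hmem]
      exact (polarizationPairingOne_diagPow_eq_smul_iff hC0 hCtop hp₂ c s).2 hc₂

/-- **`L(B^{r+1} × C^{s+1})(ℂ)|_{H¹} = {s^{⊕(r+1)} ⊕ t^{⊕(s+1)} | (s, t) ∈ G(B)(h_B) ×_{𝔾_m} G(C)(h_C)}`** for `Hom(B, C) = 0 = Hom(C, B)`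
and classes `h_B`, `h_C` with the four properties. [cite: Milne1999LefschetzClasses, §1 p. 643, Thm. 4.4, Def. 4.6 and Cor. 4.7] -/
theorem mem_map_lefschetzGroup_one_powSucc_prod_powSucc_iff (hBC : ∀ f : B ⟶ C, f = 0) (hCB : ∀ g : C ⟶ B, g = 0)
    (hQB : IsRationalClass hB) (h11B : IsOfHodgeType B.dim B.X 2 1 1 hB) (hBtop : lefschetzPow hB (B.dim - 1) 2 hB ≠ 0)
    (hndB : ∀ x : complexBetti B.X 1, (∀ y, polarizationPairingOne B.X hB (B.dim - 1) x y = 0) → x = 0)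
    (hQC : IsRationalClass hC) (h11C : IsOfHodgeType C.dim C.X 2 1 1 hC) (hCtop : lefschetzPow hC (C.dim - 1) 2 hC ≠ 0)
    (hndC : ∀ x : complexBetti C.X 1, (∀ y, polarizationPairingOne C.X hC (C.dim - 1) x y = 0) → x = 0) (r s : ℕ)
    (U : complexBetti ((B.powSucc r).prod (C.powSucc s)).X 1 ≃ₗ[ℂ] complexBetti ((B.powSucc r).prod (C.powSucc s)).X 1) :
    U ∈ (lefschetzGroup ((B.powSucc r).prod (C.powSucc s)).dim ((B.powSucc r).prod (C.powSucc s)).X).map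
        (Pi.evalMonoidHom (fun k : ℕ ↦ complexBetti ((B.powSucc r).prod (C.powSucc s)).X k ≃ₗ[ℂ]
          complexBetti ((B.powSucc r).prod (C.powSucc s)).X k) 1) ↔
      ∃ p ∈ similitudeCentralizerGroupFibreProd B C hB hC, prodBlockDiagEquiv (diagPow B p.1 r) (diagPow C p.2 s) = U := by
  rw [lefschetzGroup_map_one_powSucc_prod_powSucc_eq_similitudeCentralizerGroup B C hQB h11B hBtop hndB hQC h11C hCtop hndC r s]
  exact mem_similitudeCentralizerGroup_powSucc_prod_powSucc_iff B C hBC hCB hBtop hCtop r s U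

/-- **`L(B^{r+1} × C^{s+1})(ℂ)|_{H¹} ≅ G(B)(h_B) ×_{𝔾_m} G(C)(h_C)`**, `(s, t) ↦ s^{⊕(r+1)} ⊕ t^{⊕(s+1)}`, as abstract groups, for
`Hom(B, C) = 0 = Hom(C, B)` and classes `h_B`, `h_C` with the four properties — Cor. 4.7 for two isogeny types with
multiplicities. [cite: Milne1999LefschetzClasses, Def. 4.6, Cor. 4.7 (pp. 659–660) and Thm. 4.4] -/
theorem nonempty_map_lefschetzGroup_one_powSucc_prod_powSucc_mulEquiv_fibreProd (hBC : ∀ f : B ⟶ C, f = 0)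
    (hCB : ∀ g : C ⟶ B, g = 0)
    (hQB : IsRationalClass hB) (h11B : IsOfHodgeType B.dim B.X 2 1 1 hB) (hBtop : lefschetzPow hB (B.dim - 1) 2 hB ≠ 0)
    (hndB : ∀ x : complexBetti B.X 1, (∀ y, polarizationPairingOne B.X hB (B.dim - 1) x y = 0) → x = 0)
    (hQC : IsRationalClass hC) (h11C : IsOfHodgeType C.dim C.X 2 1 1 hC) (hCtop : lefschetzPow hC (C.dim - 1) 2 hC ≠ 0)
    (hndC : ∀ x : complexBetti C.X 1, (∀ y, polarizationPairingOne C.X hC (C.dim - 1) x y = 0) → x = 0) (r s : ℕ) :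
    Nonempty ((lefschetzGroup ((B.powSucc r).prod (C.powSucc s)).dim ((B.powSucc r).prod (C.powSucc s)).X).map
        (Pi.evalMonoidHom (fun k : ℕ ↦ complexBetti ((B.powSucc r).prod (C.powSucc s)).X k ≃ₗ[ℂ]
          complexBetti ((B.powSucc r).prod (C.powSucc s)).X k) 1) ≃*
      similitudeCentralizerGroupFibreProd B C hB hC) := by
  let D : (complexBetti B.X 1 ≃ₗ[ℂ] complexBetti B.X 1) × (complexBetti C.X 1 ≃ₗ[ℂ] complexBetti C.X 1) →*
      (complexBetti ((B.powSucc r).prod (C.powSucc s)).X 1 ≃ₗ[ℂ] complexBetti ((B.powSucc r).prod (C.powSucc s)).X 1) :=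
    { toFun := fun p ↦ prodBlockDiagEquiv (diagPow B p.1 r) (diagPow C p.2 s)
      map_one' := by
        change prodBlockDiagEquiv (diagPow B 1 r) (diagPow C 1 s) = 1
        rw [diagPow_one, diagPow_one, prodBlockDiagEquiv_one]
      map_mul' := fun p q ↦ by
        change prodBlockDiagEquiv (diagPow B (p.1 * q.1) r) (diagPow C (p.2 * q.2) s) = _
        rw [diagPow_mul, diagPow_mul, prodBlockDiagEquiv_mul] }
  have hD : (similitudeCentralizerGroupFibreProd B C hB hC).map D =
      (lefschetzGroup ((B.powSucc r).prod (C.powSucc s)).dim ((B.powSucc r).prod (C.powSucc s)).X).map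
        (Pi.evalMonoidHom (fun k : ℕ ↦ complexBetti ((B.powSucc r).prod (C.powSucc s)).X k ≃ₗ[ℂ]
          complexBetti ((B.powSucc r).prod (C.powSucc s)).X k) 1) := by
    ext U
    rw [Subgroup.mem_map,
      mem_map_lefschetzGroup_one_powSucc_prod_powSucc_iff B C hBC hCB hQB h11B hBtop hndB hQC h11C hCtop hndC r s U]
    rfl
  have hinj : Function.Injective (D.subgroupMap (similitudeCentralizerGroupFibreProd B C hB hC)) := by
    rintro ⟨p, hp⟩ ⟨q, hq⟩ e
    have e' : prodBlockDiagEquiv (diagPow B p.1 r) (diagPow C p.2 s) = prodBlockDiagEquiv (diagPow B q.1 r) (diagPow C q.2 s) :=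
      congrArg Subtype.val e
    have e₁ : diagPow B p.1 r = diagPow B q.1 r := by
      refine LinearEquiv.toLinearMap_injective ?_
      rw [← prodRestrictFst_prodBlockDiag (diagPow B p.1 r).toLinearMap (diagPow C p.2 s).toLinearMap,
        ← prodRestrictFst_prodBlockDiag (diagPow B q.1 r).toLinearMap (diagPow C q.2 s).toLinearMap,
        ← coe_prodBlockDiagEquiv, ← coe_prodBlockDiagEquiv, e']
    have e₂ : diagPow C p.2 s = diagPow C q.2 s := by
      refine LinearEquiv.toLinearMap_injective ?_
      rw [← prodRestrictSnd_prodBlockDiag (diagPow B p.1 r).toLinearMap (diagPow C p.2 s).toLinearMap,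
        ← prodRestrictSnd_prodBlockDiag (diagPow B q.1 r).toLinearMap (diagPow C q.2 s).toLinearMap,
        ← coe_prodBlockDiagEquiv, ← coe_prodBlockDiagEquiv, e']
    exact Subtype.ext (Prod.ext (diagPow_injective (A := B) r e₁) (diagPow_injective (A := C) s e₂))
  exact ⟨((MulEquiv.ofBijective _ ⟨hinj, MonoidHom.subgroupMap_surjective _ _⟩).trans (MulEquiv.subgroupCongr hD)).symm⟩

/-- **`L(B^{r+1} × C^{s+1})(ℂ)|_{H¹} ≅ G(B)(h_B) ×_{𝔾_m} G(C)(h_C)` for polarization classes `h_B`, `h_C`**, `Hom(B, C) = 0 = Hom(C, B)`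
(`dim B, dim C ≥ 1`). [cite: Milne1999LefschetzClasses, Def. 4.6, Cor. 4.7 (pp. 659–660) and Thm. 4.4] [cite: Andre1996Motifs, §1.1 (p. 10)] -/
theorem nonempty_map_lefschetzGroup_one_powSucc_prod_powSucc_mulEquiv_fibreProd_of_isPolarizationClass
    (hBC : ∀ f : B ⟶ C, f = 0) (hCB : ∀ g : C ⟶ B, g = 0) (hpolB : IsPolarizationClass B.dim B.X hB)
    (hpolC : IsPolarizationClass C.dim C.X hC) (hB1 : 1 ≤ B.dim) (hC1 : 1 ≤ C.dim) (r s : ℕ) :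
    Nonempty ((lefschetzGroup ((B.powSucc r).prod (C.powSucc s)).dim ((B.powSucc r).prod (C.powSucc s)).X).map
        (Pi.evalMonoidHom (fun k : ℕ ↦ complexBetti ((B.powSucc r).prod (C.powSucc s)).X k ≃ₗ[ℂ]
          complexBetti ((B.powSucc r).prod (C.powSucc s)).X k) 1) ≃*
      similitudeCentralizerGroupFibreProd B C hB hC) :=
  nonempty_map_lefschetzGroup_one_powSucc_prod_powSucc_mulEquiv_fibreProd B C hBC hCB hpolB.isRationalClass
    (isOfHodgeType_of_mem_algebraicClasses_of_isSmoothProjective AbelianVariety.isSmoothProjective_holds 1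
      hpolB.mem_algebraicClasses)
    (AbelianVariety.lefschetzPow_self_ne_zero_of_hasHardLefschetzProperty hB1 hpolB.hasHardLefschetz)
    (fun _ hx ↦ eq_zero_of_forall_polarizationPairingOne_eq_zero_of_hasHardLefschetzProperty hB1 hpolB.hasHardLefschetz hx)
    hpolC.isRationalClass
    (isOfHodgeType_of_mem_algebraicClasses_of_isSmoothProjective AbelianVariety.isSmoothProjective_holds 1
      hpolC.mem_algebraicClasses)
    (AbelianVariety.lefschetzPow_self_ne_zero_of_hasHardLefschetzProperty hC1 hpolC.hasHardLefschetz)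
    (fun _ hx ↦ eq_zero_of_forall_polarizationPairingOne_eq_zero_of_hasHardLefschetzProperty hC1 hpolC.hasHardLefschetz hx) r s

/-! ### §3 The isogeny class of `B^{r+1} × C^{s+1}` -/

variable {B C} {X : AbelianVariety ℂ}

/-- **`X ∼ B^{r+1} × C^{s+1}`, `Hom(B, C) = 0 = Hom(C, B)` ⟹ `L(X)(ℂ)|_{H¹} ≅ G(B)(h_B) ×_{𝔾_m} G(C)(h_C)`** for polarization classes
`h_B`, `h_C` (`dim B, dim C ≥ 1`) — «an isogeny `A → A₁^{r₁} × A₂^{r₂}` […] defines an isomorphism `(L(A), l(A)) → ∏ (L(Aᵢ), l(Aᵢ))`»,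
on `H¹`. [cite: Milne1999LefschetzClasses, Cor. 4.7 (pp. 659–660), Def. 4.6 and Thm. 4.4] -/
theorem nonempty_map_lefschetzGroup_one_mulEquiv_fibreProd_of_isIsogenous_powSucc_prod_powSucc
    (hBC : ∀ f : B ⟶ C, f = 0) (hCB : ∀ g : C ⟶ B, g = 0) (hpolB : IsPolarizationClass B.dim B.X hB)
    (hpolC : IsPolarizationClass C.dim C.X hC) (hB1 : 1 ≤ B.dim) (hC1 : 1 ≤ C.dim) (r s : ℕ)
    (h : AbelianVariety.IsIsogenous X ((B.powSucc r).prod (C.powSucc s))) :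
    Nonempty ((lefschetzGroup X.dim X.X).map (Pi.evalMonoidHom (fun k : ℕ ↦ complexBetti X.X k ≃ₗ[ℂ] complexBetti X.X k) 1) ≃*
      similitudeCentralizerGroupFibreProd B C hB hC) := by
  obtain ⟨e₁⟩ := nonempty_map_lefschetzGroup_one_mulEquiv_of_isIsogenous h
  obtain ⟨e₂⟩ := nonempty_map_lefschetzGroup_one_powSucc_prod_powSucc_mulEquiv_fibreProd_of_isPolarizationClass B C hBC hCB
    hpolB hpolC hB1 hC1 r s
  exact ⟨e₁.trans e₂⟩

/-- **Cor. 4.7 for two simple isogeny types**: `B`, `C` simple and non-isogenous with polarization classes `h_B`, `h_C`,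
`X ∼ B^{r+1} × C^{s+1}` ⟹ `L(X)(ℂ)|_{H¹} ≅ G(B)(h_B) ×_{𝔾_m} G(C)(h_C)`. [cite: Milne1999LefschetzClasses, Cor. 4.7 (pp. 659–660) and Def. 4.6]
[cite: MumfordAV1970, §19 Cor. 2 of Thm. 1 (p. 174)] -/
theorem nonempty_map_lefschetzGroup_one_mulEquiv_fibreProd_of_isSimple_of_isIsogenous_powSucc_prod_powSucc
    (hBs : AbelianVariety.IsSimple B) (hCs : AbelianVariety.IsSimple C) (hBC : ¬ AbelianVariety.IsIsogenous B C)
    (hpolB : IsPolarizationClass B.dim B.X hB) (hpolC : IsPolarizationClass C.dim C.X hC) (hB1 : 1 ≤ B.dim)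
    (hC1 : 1 ≤ C.dim) (r s : ℕ) (h : AbelianVariety.IsIsogenous X ((B.powSucc r).prod (C.powSucc s))) :
    Nonempty ((lefschetzGroup X.dim X.X).map (Pi.evalMonoidHom (fun k : ℕ ↦ complexBetti X.X k ≃ₗ[ℂ] complexBetti X.X k) 1) ≃*
      similitudeCentralizerGroupFibreProd B C hB hC) :=
  nonempty_map_lefschetzGroup_one_mulEquiv_fibreProd_of_isIsogenous_powSucc_prod_powSucc
    (hom_eq_zero_of_isSimple_of_not_isIsogenous hBs hCs hBC)
    (hom_eq_zero_of_isSimple_of_not_isIsogenous hCs hBs fun h' ↦ hBC h'.symm') hpolB hpolC hB1 hC1 r s h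

end Product

end Literature.AlgebraicGeometry.Milne1999

end
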